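import Literature.AlgebraicGeometry.Frobenioids.Cor411AsPrinted
import Literature.AlgebraicGeometry.Frobenioids.Cor411iAsPrinted
import Literature.AlgebraicGeometry.Frobenioids.ModelFrobenioidStandardProofs
import Literature.AlgebraicGeometry.Frobenioids.ModelFrobenioidRationallyStandardProofs
import Literature.AlgebraicGeometry.Frobenioids.ModelFrobenioidPhiBirat
import HarnessLib

/-!
# Frobenioids I, Corollary 4.11 (i)–(iv) at THE model Frobenioid of Theorem 5.2 — over slim bases of
# FSMFF-type, for every equivalence `Ψ : C₁ ⥲ C₂`

Mochizuki, *The geometry of Frobenioids I: the general theory*, Kyushu J. Math. **62** (2008) 293–400,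
kurims text: Corollary 4.11 (i)–(iv) pp. 91–92 (category-theoreticity of the base category, of the divisor
monoid over it and of the functor `C → F_Φ` to the elementary Frobenioid)
[cite: MochizukiFrdI2008, Cor. 4.11 p.91]; Theorem 5.2 (i)–(iii) pp. 100–101 (the model Frobenioid `C` of
divisor data `(Φ, B, Div_B)` over `D`: "(ii) `C` is a Frobenioid of isotropic and model type"; "(iii) `C` is of
standard type if and only if (a) if `Φ` is the zero monoid, then `C` admits a Frobenius-compact object; (b) `D`
is of FSMFF-type; (c) `Φ` is non-dilating") [cite: MochizukiFrdI2008, Thm. 5.2 p.100]; Definition 4.5 (ii)/(iv)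
p. 86 (rational objects; "if `D` is slim, then it is Div-slim").

PROOF-ONLY file (cell abc-iut, layer L1, seat abc-iut-L1-t14; node FrdI:Cor4.11 at THE generic carrier of
[FrdI] §5), 0 definitions. The tree holds the typed Cor. 4.11 (i)–(iv) AS PRINTED for every pair of
Frobenioids with perf-factorial `Φ_i` (`FrdI.cor411ii_ofFunctor`, `FrdI.cor411iii/iv_ofFunctor`,
`FrdI.exists_cor411iv_data_ofFunctor` — `Cor411AsPrinted.lean`, seat abc-iut-L1-d6; `PreFrobenioid.cor411i_ofFunctor`
— `Cor411iAsPrinted.lean`, this seat) and instance closers at the `p`-adic, tempered-`p`-adic, `C₀` and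
arithmetic carriers (`Cor411Padic.lean`, `Cor411PadicTempered.lean`, `BaseSectionsOfObjectsCor57NonVacuity.lean`),
but none at the MODEL Frobenioid `ModelFrobenioid Φ B Div_B` itself — the carrier of every Frobenioid "of model
type" downstream ([FrdII] Ex. 1.1, [EtTh] Def. 3.6 (ii) tempered Frobenioids, [IUTchI] Ex. 5.1 (ii) global
`ℱ^⊛`). This file is that generic-carrier twin of `Cor411Padic.lean`:

* `ModelFrobenioid.cor411Setting_model` — **the standing hypotheses of Cor. 4.11 HOLD** for every equivalence
  between model Frobenioids under the standing hypotheses of Thm. 5.2 (`Hypotheses Φ_i B_i`), over SLIM bases of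
  FSMFF-type with `Φ_i` non-dilating and Thm. 5.2 (iii)(a): Div-slim ⇐ slim (`isDivSlim_of_isSlim`), standard
  type ⇐ Thm. 5.2 (iii) (seat abc-iut-L1-t2's `standardTypeIff_holds`), hypothesis (b) BY NAME;
  `cor411Setting_model_of_not_isZeroMonoid` — the same with (iii)(a) and hypothesis (b) IDLE when `Φ_i` are not
  the zero monoid (a model Frobenioid is of group-like type iff `Φ` is the zero monoid, `data_isOfGroupLikeType_iff`);
* `ModelFrobenioid.cor411ii_model` — the typed Cor. 4.11 (ii) with NO hypothesis on the bases (antecedent kept),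
  and `exists_oneUniqueSquare_base_model` — its conclusion outright: a `1`-unique `Ψ^Base : D₁ ⥲ D₂` with rigid
  composites;
* `ModelFrobenioid.cor411iii_model` / `cor411iv_model` — the typed (iii)/(iv) at ANY Def. 4.5 (iii) parameters,
  and `exists_cor411iv_data_model` / `exists_divisorTransport_model` — the conclusion of (iv)/(iii) outright: the
  data `(Ψ^Base, Ψ^Φ, η)` with `Ψ^Base` an equivalence, Frobenius degrees preserved, the divisor formula
  `Div(Ψ φ) = η_A^* Ψ^Φ(Div φ)` on all arrows, the typed rigidity clause `Cor411ivRigid` and rigid `D₂`-valued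
  composites — for `C₁` of rational type at THE birationalization (Def. 4.5 (ii), `PrimarySupp`), BY NAME;
* `ModelFrobenioid.exists_cor411i_model` — Cor. 4.11 (i): `Ψ^istr` and the typed `Cor411i`;
* `ModelFrobenioid.isRational_biratData_of_exists_divB` — the rationality binder discharged from the divisor
  data alone: if for every prime `𝔭` of `Φ(A_D)` some rational function `f ∈ B(A_D)` has `Div_B(f) = [a] − [b]` with
  `𝔭 ∈ Supp(a)`, `𝔭 ∉ Supp(b)` (seat abc-iut-L6-t10's criterion `isStrictlyRational_biratData_iff`, Thm. 5.2 (ii)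
  "Moreover"), then every object is rational — so that consumers state rationality on `(Φ, B, Div_B)`.

Inhabited carriers of record (vacuity guard): the `p`-adic Frobenioid data `PadicFrd.Datum D p` of [FrdII]
Ex. 1.1 — whose `frobenioid` IS `ModelFrobenioid d.Φ d.B d.divB`, with every binder below discharged over slim bases
of FSM-type in `Cor411Padic.lean` (seat abc-iut-w4-d109) — and the global `ℱ^⊛(†𝒟^⊚) = ModelFrobenioid Δ.Φ Δ.B Δ.div`
over `ℬ(G)⁰` of [IUTchI] Ex. 5.1 (ii) (`GlobalFrobenioidsModelFrobenioid.lean`, seat abc-iut-w4-d050).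

Binders left, all BY NAME and all print's: `Hypotheses Φ_i B_i` (Thm. 5.2), `Φ_i` perf-factorial (§4 standing
assumption p. 75), `IsSlim D_i` + `IsOfFSMFFType D_i` + `IsNonDilatingOn Φ_i` (Cor. 4.11 / Thm. 5.2 (iii)),
`¬ IsZeroMonoid Φ_i` or Thm. 5.2 (iii)(a) + hypothesis (b), and rationality of `C₁` for (iii)/(iv). No statement of
the paper is restated or strengthened; nothing here bears on, or takes a side on, [IUTchIII] Cor. 3.12.
-/

noncomputable section

namespace Literature.AlgebraicGeometry.Frobenioids

open CategoryTheory Opposite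
open PreFrobenioid PreFrobenioidData

namespace ModelFrobenioid

universe w v u

section TwoData

variable {D₁ : Type u} [Category.{v} D₁] {Φ₁ B₁ : D₁ᵒᵖ ⥤ CommMonCat.{w}} {DivB₁ : B₁ ⟶ monoidGp Φ₁}
variable {D₂ : Type u} [Category.{v} D₂] {Φ₂ B₂ : D₂ᵒᵖ ⥤ CommMonCat.{w}} {DivB₂ : B₂ ⟶ monoidGp Φ₂}

/-! ### The Cor. 4.11 hypothesis package at a pair of model Frobenioids -/

/-- **The standing hypotheses of [FrdI] Cor. 4.11 HOLD for every equivalence `Ψ : C₁ ⥲ C₂` between the model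
Frobenioids of divisor data `(Φ_i, B_i, Div_{B_i})` satisfying the standing hypotheses of Thm. 5.2, over SLIM
bases `D_i` of FSMFF-type with `Φ_i` non-dilating and Thm. 5.2 (iii)(a)** ("if `Φ` is the zero monoid, then `C`
admits a Frobenius-compact object"): `D_i` Div-slim (slim ⇒ Div-slim, Def. 4.5 (iv)), `C_i` of standard type
(Thm. 5.2 (iii)), hypothesis (b) "if `C₁`, `C₂` are of group-like type, then `Ψ` and some quasi-inverse preserve
base-isomorphisms" kept BY NAME. [cite: MochizukiFrdI2008, Cor. 4.11 p.91] [cite: MochizukiFrdI2008, Thm. 5.2(iii) p.101] -/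
theorem cor411Setting_model (h₁ : Hypotheses Φ₁ B₁) (h₂ : Hypotheses Φ₂ B₂) (hsl₁ : IsSlim D₁) (hsl₂ : IsSlim D₂)
    (hfs₁ : IsOfFSMFFType D₁) (hfs₂ : IsOfFSMFFType D₂) (hnd₁ : IsNonDilatingOn Φ₁) (hnd₂ : IsNonDilatingOn Φ₂)
    (ha₁ : IsZeroMonoid Φ₁ → ∃ X : ModelFrobenioid Φ₁ B₁ DivB₁, (data Φ₁ B₁ DivB₁).IsFrobeniusCompact X)
    (ha₂ : IsZeroMonoid Φ₂ → ∃ X : ModelFrobenioid Φ₂ B₂ DivB₂, (data Φ₂ B₂ DivB₂).IsFrobeniusCompact X)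
    (Ψ : ModelFrobenioid Φ₁ B₁ DivB₁ ≌ ModelFrobenioid Φ₂ B₂ DivB₂)
    (hB : (data Φ₁ B₁ DivB₁).HypB (data Φ₂ B₂ DivB₂) Ψ) :
    (data Φ₁ B₁ DivB₁).Cor411Setting (data Φ₂ B₂ DivB₂) Ψ where
  divSlim := ⟨PreFrobenioidData.isDivSlim_of_isSlim _ hsl₁, PreFrobenioidData.isDivSlim_of_isSlim _ hsl₂⟩
  standard := ⟨(standardTypeIff_holds Φ₁ B₁ DivB₁ h₁).mpr ⟨ha₁, hfs₁, hnd₁⟩,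
    (standardTypeIff_holds Φ₂ B₂ DivB₂ h₂).mpr ⟨ha₂, hfs₂, hnd₂⟩⟩
  hypB := hB

/-- **The Cor. 4.11 hypothesis package for model Frobenioids whose divisor monoids `Φ_i` are NOT the zero
monoid** (the case of every consumer: `p`-adic, tempered, global divisor monoids are non-trivial), over slim bases
of FSMFF-type with `Φ_i` non-dilating: Thm. 5.2 (iii)(a) and hypothesis (b) of Cor. 4.11 are then IDLE, their
common antecedent "`C_i` of group-like type ⟺ `Φ_i` is the zero monoid" (`data_isOfGroupLikeType_iff`) being
refuted. [cite: MochizukiFrdI2008, Cor. 4.11 p.91] [cite: MochizukiFrdI2008, Thm. 5.2(iii) p.101] -/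
theorem cor411Setting_model_of_not_isZeroMonoid (h₁ : Hypotheses Φ₁ B₁) (h₂ : Hypotheses Φ₂ B₂)
    (hsl₁ : IsSlim D₁) (hsl₂ : IsSlim D₂) (hfs₁ : IsOfFSMFFType D₁) (hfs₂ : IsOfFSMFFType D₂)
    (hnd₁ : IsNonDilatingOn Φ₁) (hnd₂ : IsNonDilatingOn Φ₂) (hz₁ : ¬ IsZeroMonoid Φ₁) (hz₂ : ¬ IsZeroMonoid Φ₂)
    (Ψ : ModelFrobenioid Φ₁ B₁ DivB₁ ≌ ModelFrobenioid Φ₂ B₂ DivB₂) :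
    (data Φ₁ B₁ DivB₁).Cor411Setting (data Φ₂ B₂ DivB₂) Ψ :=
  cor411Setting_model h₁ h₂ hsl₁ hsl₂ hfs₁ hfs₂ hnd₁ hnd₂ (fun h => absurd h hz₁) (fun h => absurd h hz₂) Ψ
    fun hg₁ _ => absurd ((data_isOfGroupLikeType_iff Φ₁ B₁ DivB₁).mp hg₁) hz₁

/-! ### Corollary 4.11 (ii) -/

/-- **[FrdI] Cor. 4.11 (ii) AS TYPED for every equivalence `Ψ : C₁ ⥲ C₂` of model Frobenioids with
perf-factorial `Φ_i`** — NO hypothesis on the bases (the antecedent `Cor411Setting` is kept): the as-printed closer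
`FrdI.cor411ii_ofFunctor` (seat abc-iut-L1-d6, from Thm. 3.4 (ii) as printed) at Thm. 5.2 (ii)
(`Hypotheses.isFrobenioid`). [cite: MochizukiFrdI2008, Cor. 4.11 (ii) p.91] -/
theorem cor411ii_model (h₁ : Hypotheses Φ₁ B₁) (h₂ : Hypotheses Φ₂ B₂)
    (hpf₁ : Objectwise (fun M _ => IsPerfFactorial M) Φ₁) (hpf₂ : Objectwise (fun M _ => IsPerfFactorial M) Φ₂)
    (Ψ : ModelFrobenioid Φ₁ B₁ DivB₁ ≌ ModelFrobenioid Φ₂ B₂ DivB₂) :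
    (data Φ₁ B₁ DivB₁).Cor411ii (data Φ₂ B₂ DivB₂) Ψ :=
  FrdI.cor411ii_ofFunctor (h₁.isFrobenioid Φ₁ B₁ DivB₁) (h₂.isFrobenioid Φ₂ B₂ DivB₂) Ψ hpf₁ hpf₂

/-- **The `1`-unique `Ψ^Base : D₁ ⥲ D₂` induced by `Ψ`** (Cor. 4.11 (ii) p. 91) for model Frobenioids with
perf-factorial, non-dilating, non-zero `Φ_i` over slim bases of FSMFF-type: for every `Ψ : C₁ ⥲ C₂` there is
`Ψ^Base` with a `1`-unique `1`-commutative square over the projections `C_i → D_i`, and the composites `C₁ → D₂`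
are rigid. [cite: MochizukiFrdI2008, Cor. 4.11 (ii) p.91] -/
theorem exists_oneUniqueSquare_base_model (h₁ : Hypotheses Φ₁ B₁) (h₂ : Hypotheses Φ₂ B₂)
    (hpf₁ : Objectwise (fun M _ => IsPerfFactorial M) Φ₁) (hpf₂ : Objectwise (fun M _ => IsPerfFactorial M) Φ₂)
    (hsl₁ : IsSlim D₁) (hsl₂ : IsSlim D₂) (hfs₁ : IsOfFSMFFType D₁) (hfs₂ : IsOfFSMFFType D₂)
    (hnd₁ : IsNonDilatingOn Φ₁) (hnd₂ : IsNonDilatingOn Φ₂) (hz₁ : ¬ IsZeroMonoid Φ₁) (hz₂ : ¬ IsZeroMonoid Φ₂)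
    (Ψ : ModelFrobenioid Φ₁ B₁ DivB₁ ≌ ModelFrobenioid Φ₂ B₂ DivB₂) :
    ∃ ΨBase : D₁ ⥤ D₂,
      OneUniqueSquare Ψ.functor (data Φ₁ B₁ DivB₁).base (data Φ₂ B₂ DivB₂).base ΨBase ∧
        IsRigidFunctor (Ψ.functor ⋙ (data Φ₂ B₂ DivB₂).base) ∧ IsRigidFunctor ((data Φ₁ B₁ DivB₁).base ⋙ ΨBase) := by
  obtain ⟨ΨBase, hsq, hrig⟩ := cor411ii_model h₁ h₂ hpf₁ hpf₂ Ψ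
    (cor411Setting_model_of_not_isZeroMonoid h₁ h₂ hsl₁ hsl₂ hfs₁ hfs₂ hnd₁ hnd₂ hz₁ hz₂ Ψ)
  exact ⟨ΨBase, hsq, hrig hsl₁ hsl₂⟩

/-! ### Rational type of a model Frobenioid, from the divisor data -/

/-- **Every object of a model Frobenioid is rational (Def. 4.5 (ii), at THE birationalization and print's support
predicate `PrimarySupp` of Def. 2.4 (i)(d)) as soon as the divisor data separate primes by rational functions**:
if for every `A_D ∈ Ob(D)` and every prime `𝔭` of `Φ(A_D)` there are `a, b ∈ Φ(A_D)` and `f ∈ B(A_D)` with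
`[a] − [b] = Div_B(f)`, `𝔭 ∈ Supp(a)`, `𝔭 ∉ Supp(b)` — by seat abc-iut-L6-t10's Thm. 5.2 (ii) "Moreover" criterion
`isStrictlyRational_biratData_iff` (`Φ^birat = Div_B(B)`) every object is strictly rational, hence rational. This
is the form in which the rationality binder of Cor. 4.11 (iii)/(iv) is discharged at a concrete `(Φ, B, Div_B)`
([FrdI] Thm. 6.4 (i) p. 115: "immediate from the definition of `B`"). [cite: MochizukiFrdI2008, Def. 4.5 (ii) p.86] -/
theorem isRational_biratData_of_exists_divB (h₁ : Hypotheses Φ₁ B₁)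
    (hsep : ∀ (X : D₁) (𝔭 : Primes (Φ₁.obj (op X))), ∃ a b : Φ₁.obj (op X),
      (∃ f : B₁.obj (op X),
          Algebra.GrothendieckGroup.of a / Algebra.GrothendieckGroup.of b = divB Φ₁ B₁ DivB₁ (op X) f) ∧
        PrimarySupp a 𝔭 ∧ ¬ PrimarySupp b 𝔭)
    (A : ModelFrobenioid Φ₁ B₁ DivB₁) :
    PreFrobenioidData.IsRational
      (biratData (h₁.isFrobenioid Φ₁ B₁ DivB₁) (hasBiratSquares_of_isFrobenioid (h₁.isFrobenioid Φ₁ B₁ DivB₁)))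
      (S := data Φ₁ B₁ DivB₁) (fun a 𝔭 => PrimarySupp a 𝔭) A :=
  isRational_of_isStrictlyRational (h₁.isFrobenioid Φ₁ B₁ DivB₁) _ (fun a 𝔭 => PrimarySupp a 𝔭) A
    ((isStrictlyRational_biratData_iff h₁.isGroupLike_rat h₁.isDivisorial (h₁.isFrobenioid Φ₁ B₁ DivB₁) _
      (fun a 𝔭 => PrimarySupp a 𝔭) A).mpr (hsep A.base))

/-! ### Corollary 4.11 (iii), (iv) -/

/-- **[FrdI] Cor. 4.11 (iii) AS TYPED, at ANY Def. 4.5 (iii) parameters, for every equivalence of model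
Frobenioids with perf-factorial `Φ_i`, `C₁` of rational type at THE birationalization** — NO hypothesis on the
bases (the as-printed closer `FrdI.cor411iii_ofFunctor`). [cite: MochizukiFrdI2008, Cor. 4.11 (iii) p.92] -/
theorem cor411iii_model (h₁ : Hypotheses Φ₁ B₁) (h₂ : Hypotheses Φ₂ B₂)
    (hpf₁ : Objectwise (fun M _ => IsPerfFactorial M) Φ₁) (hpf₂ : Objectwise (fun M _ => IsPerfFactorial M) Φ₂)
    (hrat₁ : ∀ A : ModelFrobenioid Φ₁ B₁ DivB₁, PreFrobenioidData.IsRational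
      (biratData (h₁.isFrobenioid Φ₁ B₁ DivB₁) (hasBiratSquares_of_isFrobenioid (h₁.isFrobenioid Φ₁ B₁ DivB₁)))
      (S := data Φ₁ B₁ DivB₁) (fun a 𝔭 => PrimarySupp a 𝔭) A)
    (Ψ : ModelFrobenioid Φ₁ B₁ DivB₁ ≌ ModelFrobenioid Φ₂ B₂ DivB₂)
    (R₁ : (data Φ₁ B₁ DivB₁).RSParams) (R₂ : (data Φ₂ B₂ DivB₂).RSParams) :
    (data Φ₁ B₁ DivB₁).Cor411iii (data Φ₂ B₂ DivB₂) Ψ R₁ R₂ :=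
  FrdI.cor411iii_ofFunctor (h₁.isFrobenioid Φ₁ B₁ DivB₁) (h₂.isFrobenioid Φ₂ B₂ DivB₂) hpf₁ hpf₂ hrat₁ Ψ R₁ R₂

/-- **[FrdI] Cor. 4.11 (iv) AS TYPED, at ANY Def. 4.5 (iii) parameters, for every equivalence of model
Frobenioids with perf-factorial `Φ_i`, `C₁` of rational type at THE birationalization** — NO hypothesis on the
bases (the as-printed closer `FrdI.cor411iv_ofFunctor`). [cite: MochizukiFrdI2008, Cor. 4.11 (iv) p.92] -/
theorem cor411iv_model (h₁ : Hypotheses Φ₁ B₁) (h₂ : Hypotheses Φ₂ B₂)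
    (hpf₁ : Objectwise (fun M _ => IsPerfFactorial M) Φ₁) (hpf₂ : Objectwise (fun M _ => IsPerfFactorial M) Φ₂)
    (hrat₁ : ∀ A : ModelFrobenioid Φ₁ B₁ DivB₁, PreFrobenioidData.IsRational
      (biratData (h₁.isFrobenioid Φ₁ B₁ DivB₁) (hasBiratSquares_of_isFrobenioid (h₁.isFrobenioid Φ₁ B₁ DivB₁)))
      (S := data Φ₁ B₁ DivB₁) (fun a 𝔭 => PrimarySupp a 𝔭) A)
    (Ψ : ModelFrobenioid Φ₁ B₁ DivB₁ ≌ ModelFrobenioid Φ₂ B₂ DivB₂)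
    (R₁ : (data Φ₁ B₁ DivB₁).RSParams) (R₂ : (data Φ₂ B₂ DivB₂).RSParams) :
    (data Φ₁ B₁ DivB₁).Cor411iv (data Φ₂ B₂ DivB₂) Ψ R₁ R₂ :=
  FrdI.cor411iv_ofFunctor (h₁.isFrobenioid Φ₁ B₁ DivB₁) (h₂.isFrobenioid Φ₂ B₂ DivB₂) hpf₁ hpf₂ hrat₁ Ψ R₁ R₂

/-- **The conclusion of [FrdI] Cor. 4.11 (iv) outright at model Frobenioids** (category-theoreticity of the
functor `C → F_Φ` to the elementary Frobenioid): for model Frobenioids with perf-factorial, non-dilating, non-zero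
`Φ_i` over slim bases of FSMFF-type, `C₁` of rational type at THE birationalization, and EVERY `Ψ : C₁ ⥲ C₂`,
there are a `1`-unique equivalence `Ψ^Base : D₁ ⥲ D₂`, an isomorphism of functors `Ψ^Φ : Φ₁ ⥲ Φ₂` over it and
`η : Base₂ ∘ Ψ ≅ Ψ^Base ∘ Base₁` with `Ψ` preserving Frobenius degrees, `Div(Ψ φ) = η_A^* Ψ^Φ(Div φ)` for every
arrow `φ` of `C₁`, the typed rigidity clause `Cor411ivRigid`, and rigid `D₂`-valued composites — the as-printed
closer `FrdI.exists_cor411iv_data_ofFunctor` at `cor411Setting_model_of_not_isZeroMonoid`.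
[cite: MochizukiFrdI2008, Cor. 4.11 (iv) p.92] -/
theorem exists_cor411iv_data_model (h₁ : Hypotheses Φ₁ B₁) (h₂ : Hypotheses Φ₂ B₂)
    (hpf₁ : Objectwise (fun M _ => IsPerfFactorial M) Φ₁) (hpf₂ : Objectwise (fun M _ => IsPerfFactorial M) Φ₂)
    (hsl₁ : IsSlim D₁) (hsl₂ : IsSlim D₂) (hfs₁ : IsOfFSMFFType D₁) (hfs₂ : IsOfFSMFFType D₂)
    (hnd₁ : IsNonDilatingOn Φ₁) (hnd₂ : IsNonDilatingOn Φ₂) (hz₁ : ¬ IsZeroMonoid Φ₁) (hz₂ : ¬ IsZeroMonoid Φ₂)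
    (hrat₁ : ∀ A : ModelFrobenioid Φ₁ B₁ DivB₁, PreFrobenioidData.IsRational
      (biratData (h₁.isFrobenioid Φ₁ B₁ DivB₁) (hasBiratSquares_of_isFrobenioid (h₁.isFrobenioid Φ₁ B₁ DivB₁)))
      (S := data Φ₁ B₁ DivB₁) (fun a 𝔭 => PrimarySupp a 𝔭) A)
    (Ψ : ModelFrobenioid Φ₁ B₁ DivB₁ ≌ ModelFrobenioid Φ₂ B₂ DivB₂) :
    ∃ (ΨBase : D₁ ⥤ D₂) (E : (data Φ₁ B₁ DivB₁).DivisorMonoidIsoOverBase (data Φ₂ B₂ DivB₂) ΨBase)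
      (η : Ψ.functor ⋙ (data Φ₂ B₂ DivB₂).base ≅ (data Φ₁ B₁ DivB₁).base ⋙ ΨBase),
      OneUniqueSquare Ψ.functor (data Φ₁ B₁ DivB₁).base (data Φ₂ B₂ DivB₂).base ΨBase ∧
        PreservesDegFr (data Φ₁ B₁ DivB₁) (data Φ₂ B₂ DivB₂) Ψ ∧
        (∀ ⦃A A' : ModelFrobenioid Φ₁ B₁ DivB₁⦄ (φ : A ⟶ A'),
          (data Φ₂ B₂ DivB₂).div (Ψ.functor.map φ) =
            (data Φ₂ B₂ DivB₂).pull (η.hom.app A) (E.iso ((data Φ₁ B₁ DivB₁).base.obj A) ((data Φ₁ B₁ DivB₁).div φ))) ∧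
        (data Φ₁ B₁ DivB₁).Cor411ivRigid (data Φ₂ B₂ DivB₂) Ψ ΨBase E ∧
        (IsRigidFunctor (Ψ.functor ⋙ (data Φ₂ B₂ DivB₂).base) ∧ IsRigidFunctor ((data Φ₁ B₁ DivB₁).base ⋙ ΨBase)) := by
  obtain ⟨ΨBase, E, η, hsq, hdeg, hdiv, hrig, hrig'⟩ := FrdI.exists_cor411iv_data_ofFunctor
    (h₁.isFrobenioid Φ₁ B₁ DivB₁) (h₂.isFrobenioid Φ₂ B₂ DivB₂) hpf₁ hpf₂ hrat₁ Ψ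
    (cor411Setting_model_of_not_isZeroMonoid h₁ h₂ hsl₁ hsl₂ hfs₁ hfs₂ hnd₁ hnd₂ hz₁ hz₂ Ψ)
  exact ⟨ΨBase, E, η, hsq, hdeg, hdiv, hrig, hrig' hsl₁ hsl₂⟩

/-- **The conclusion of [FrdI] Cor. 4.11 (iii) outright at model Frobenioids — the divisor-monoid transport
over the base**: under the hypotheses of `exists_cor411iv_data_model`, for every `Ψ : C₁ ⥲ C₂` there are a
`1`-unique `Ψ^Base : D₁ ⥲ D₂` and an isomorphism of functors `Ψ^Φ : Φ₁ ⥲ Φ₂` lying over `Ψ^Base` (monoid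
isomorphisms `Φ₁(X) ≃* Φ₂(Ψ^Base X)` natural in `X ∈ Ob(D₁)`). [cite: MochizukiFrdI2008, Cor. 4.11 (iii) p.92] -/
theorem exists_divisorTransport_model (h₁ : Hypotheses Φ₁ B₁) (h₂ : Hypotheses Φ₂ B₂)
    (hpf₁ : Objectwise (fun M _ => IsPerfFactorial M) Φ₁) (hpf₂ : Objectwise (fun M _ => IsPerfFactorial M) Φ₂)
    (hsl₁ : IsSlim D₁) (hsl₂ : IsSlim D₂) (hfs₁ : IsOfFSMFFType D₁) (hfs₂ : IsOfFSMFFType D₂)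
    (hnd₁ : IsNonDilatingOn Φ₁) (hnd₂ : IsNonDilatingOn Φ₂) (hz₁ : ¬ IsZeroMonoid Φ₁) (hz₂ : ¬ IsZeroMonoid Φ₂)
    (hrat₁ : ∀ A : ModelFrobenioid Φ₁ B₁ DivB₁, PreFrobenioidData.IsRational
      (biratData (h₁.isFrobenioid Φ₁ B₁ DivB₁) (hasBiratSquares_of_isFrobenioid (h₁.isFrobenioid Φ₁ B₁ DivB₁)))
      (S := data Φ₁ B₁ DivB₁) (fun a 𝔭 => PrimarySupp a 𝔭) A)
    (Ψ : ModelFrobenioid Φ₁ B₁ DivB₁ ≌ ModelFrobenioid Φ₂ B₂ DivB₂) :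
    ∃ ΨBase : D₁ ⥤ D₂,
      OneUniqueSquare Ψ.functor (data Φ₁ B₁ DivB₁).base (data Φ₂ B₂ DivB₂).base ΨBase ∧
        Nonempty ((data Φ₁ B₁ DivB₁).DivisorMonoidIsoOverBase (data Φ₂ B₂ DivB₂) ΨBase) := by
  obtain ⟨ΨBase, E, -, hsq, -⟩ := exists_cor411iv_data_model h₁ h₂ hpf₁ hpf₂ hsl₁ hsl₂ hfs₁ hfs₂ hnd₁ hnd₂ hz₁ hz₂
    hrat₁ Ψ
  exact ⟨ΨBase, hsq, ⟨E⟩⟩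

/-- **"`Ψ` preserves Frobenius degrees"** (Cor. 4.11 (iv) / Thm. 3.4 (iii)) for every equivalence of model
Frobenioids with non-dilating, non-zero `Φ_i` over slim bases of FSMFF-type — no perf-factoriality or rationality
needed (`FrdI.preservesDegFr_of_cor411Setting`). [cite: MochizukiFrdI2008, Cor. 4.11 (iv) p.92] -/
theorem preservesDegFr_model (h₁ : Hypotheses Φ₁ B₁) (h₂ : Hypotheses Φ₂ B₂)
    (hsl₁ : IsSlim D₁) (hsl₂ : IsSlim D₂) (hfs₁ : IsOfFSMFFType D₁) (hfs₂ : IsOfFSMFFType D₂)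
    (hnd₁ : IsNonDilatingOn Φ₁) (hnd₂ : IsNonDilatingOn Φ₂) (hz₁ : ¬ IsZeroMonoid Φ₁) (hz₂ : ¬ IsZeroMonoid Φ₂)
    (Ψ : ModelFrobenioid Φ₁ B₁ DivB₁ ≌ ModelFrobenioid Φ₂ B₂ DivB₂) :
    PreservesDegFr (data Φ₁ B₁ DivB₁) (data Φ₂ B₂ DivB₂) Ψ :=
  FrdI.preservesDegFr_of_cor411Setting (h₁.isFrobenioid Φ₁ B₁ DivB₁) (h₂.isFrobenioid Φ₂ B₂ DivB₂) Ψ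
    (cor411Setting_model_of_not_isZeroMonoid h₁ h₂ hsl₁ hsl₂ hfs₁ hfs₂ hnd₁ hnd₂ hz₁ hz₂ Ψ)

/-! ### Corollary 4.11 (i) -/

/-- **[FrdI] Cor. 4.11 (i) at model Frobenioids** with perf-factorial, non-dilating, non-zero `Φ_i` over slim
bases of FSMFF-type: for every `Ψ : C₁ ⥲ C₂` there is THE restriction `Ψ^istr : C₁^istr ⥲ C₂^istr` of `Ψ`
(Thm. 3.4 (i)) together with a `1`-unique `Ψ^un-tr : C₁^un-tr ⥲ C₂^un-tr` `1`-commuting with the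
unit-trivialisations, both composites rigid — the typed `Cor411i` for `Ψ^istr` (this seat's as-printed closer
`PreFrobenioid.cor411i_ofFunctor` at `cor411Setting_model_of_not_isZeroMonoid`). [cite: MochizukiFrdI2008, Cor. 4.11 (i) p.91] -/
theorem exists_cor411i_model (h₁ : Hypotheses Φ₁ B₁) (h₂ : Hypotheses Φ₂ B₂)
    (hpf₁ : Objectwise (fun M _ => IsPerfFactorial M) Φ₁) (hpf₂ : Objectwise (fun M _ => IsPerfFactorial M) Φ₂)
    (hsl₁ : IsSlim D₁) (hsl₂ : IsSlim D₂) (hfs₁ : IsOfFSMFFType D₁) (hfs₂ : IsOfFSMFFType D₂)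
    (hnd₁ : IsNonDilatingOn Φ₁) (hnd₂ : IsNonDilatingOn Φ₂) (hz₁ : ¬ IsZeroMonoid Φ₁) (hz₂ : ¬ IsZeroMonoid Φ₂)
    (Ψ : ModelFrobenioid Φ₁ B₁ DivB₁ ≌ ModelFrobenioid Φ₂ B₂ DivB₂) :
    ∃ Ψistr : (data Φ₁ B₁ DivB₁).Istr ≌ (data Φ₂ B₂ DivB₂).Istr,
      Ψistr.functor ⋙ (data Φ₂ B₂ DivB₂).istrι = (data Φ₁ B₁ DivB₁).istrι ⋙ Ψ.functor ∧
        (data Φ₁ B₁ DivB₁).Cor411i (data Φ₂ B₂ DivB₂) Ψ Ψistr.functor :=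
  PreFrobenioid.cor411i_ofFunctor (h₁.isFrobenioid Φ₁ B₁ DivB₁) (h₂.isFrobenioid Φ₂ B₂ DivB₂) hpf₁ hpf₂ Ψ
    (cor411Setting_model_of_not_isZeroMonoid h₁ h₂ hsl₁ hsl₂ hfs₁ hfs₂ hnd₁ hnd₂ hz₁ hz₂ Ψ)

end TwoData

end ModelFrobenioid

end Literature.AlgebraicGeometry.Frobenioids

end
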